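import Summits.ResolutionOfSingularities.ResolutionOfSingularities.Theses.FrobeniusClosing
import Summits.ResolutionOfSingularities.ResolutionOfSingularities.Theses.WildCones
import Summits.ResolutionOfSingularities.ResolutionOfSingularities.Theorems.FrobeniusClosingNoPeriodicIsolatedAtomOrderWindow
import Summits.ResolutionOfSingularities.ResolutionOfSingularities.Theorems.FrobeniusClosingNoPeriodicIsolatedAtomUnwindOfTransport
import Summits.ResolutionOfSingularities.ResolutionOfSingularities.Theorems.WildConesConeExit
import Summits.ResolutionOfSingularities.ResolutionOfSingularities.Theorems.FrobeniusClosingClosingReductionTransport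
import Summits.ResolutionOfSingularities.ResolutionOfSingularities.Theorems.WildConesNarrowRunsDie
import Summits.ResolutionOfSingularities.ResolutionOfSingularities.Theorems.FrobeniusClosingNoPeriodicIsolatedAtomStepDict
import Summits.ResolutionOfSingularities.ResolutionOfSingularities.Theorems.FrobeniusClosingNoPeriodicIsolatedAtomConeAlgebra
import HarnessLib

/-!
# Crux `NoPeriodicIsolatedAtom` (stmt-ResolutionOfSingularities-16344) — line `ridge-rank`,
# lead reshape r1 (prover-line-stmt-ResolutionOfSingularities-16344-0, 2026-08-17)

Route `ResolutionOfSingularities/FrobeniusClosing`, crux #2 (rank 2, THE CERTIFICATE): over every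
field `κ` ALGEBRAIC over `𝔽_p`, no run `c₀, …, c_r` (`r ≥ 1`) of the point-blow-up dynamics of a
height-one atom `z^p = a(u_1..u_n)` with all states ISOLATED of MULTIPLICITY `p` returns to an
isomorphic pair: `¬ PairIso c₀ c_r`.

## The idea in one paragraph (unchanged from the strategist's `ridge_rank`; see `Lines/ridge_rank.md`)

A periodic isolated chain UNWINDS (transport of successor points along the pair isomorphism,
`stub_unwind`) to an ETERNAL isolated multiplicity-`p` chain over the same `κ`, which is perfect of
characteristic `p`. For `n ≤ 2` or `p = 2` an eternal isolated chain contradicts the sibling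
route's `WildCones.ClassicalRegimes`, taken BY NAME. For `n ≥ 3`, `p` odd, every state is on the
RIDGE (`stub_orderWindow`: cleaned order exactly `p`), the near direction `e_i + τ` lies in the
additive-invariance space `L(a_p)` of the tangent cone and the invariance rank `dL` does not
increase along a ridge step (`stub_rankStep`), and `dL ≤ n − 2` on the ridge (`stub_room`). So
`dL` is eventually constant `= d ≥ 1` (`eventually_const_of_antitone`, proved) and the SHIFTED chain
(`run_add`, proved: a tail of a run is a run) is an eternal ridge chain of constant rank `d`:
`d = 1` is the hypothesis of `WildCones.NarrowRunsDie` (BY NAME), `d ≥ 2` (whence `n ≥ 4` by ROOM)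
is `stub_wideEternal`, which follows from `WildCones.ConeExit` at `m = 0` (`wideEternal_of_coneExit`,
proved).

## What the lead changed (reshapes r1–r3) and why

* `stub_unwindQP` ↦ `stub_unwind`: the conclusion keeps ONLY the eternal `Isol ∧ MultP` chain (and
  the instances `CharP κ p`, `PerfectField κ`); the quasi-periodicity `∀ m, PairIso (run m) (run (m+r))`
  and the `r`-periodicity of `dL` are DROPPED. Reason: nothing downstream used quasi-periodicity
  except as an idle hypothesis of `stub_wideRecurrent`, and producing it requires the successor of a
  pair ISOMORPHISM to be a pair ISOMORPHISM, i.e. a formal inverse-function theorem for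
  `MvPowerSeries` substitutions (not in Mathlib). Transporting `Isol`/`MultP` forward along a
  substitution homomorphism with invertible linear part needs no inverse. Periodicity of `dL` is
  replaced by eventual constancy of a non-increasing `ℕ`-valued sequence plus a shift of the run.
* DICTIONARY / ALGEBRA SEAM (reshape r2). Every use of the explicit coefficient calculus
  (`bl/dv/tr/clean` inside `step`) is concentrated in ONE stub, `stub_stepDict` (three coefficient
  identities of a single step from a multiplicity-`p` state: (a) with no cleaned degree-`p` monomial
  the successor is divisible by `u_i`; (b) the `u_i`-free degree-`p` coefficients are unchanged;
  (c) `MultP` of the successor ⇒ the CONE SHAPE `a_p(X_i, X′ + τX_i) = a_p(e_i+τ)·X_i^p + a_p(0, X′)`);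
  the other two true stubs are pure algebra about an ARBITRARY coefficient function `c′`:
  `stub_orderWindow` (power series: `u_i ∣ a′`, `a′` isolated of multiplicity `p`, `n ≥ 3` ⇒ `False`)
  and `stub_coneAlgebra` (polynomials / linear algebra: ROOM `OrdP c → dL c + 2 ≤ n`; cone shape +
  equal `u_i`-free parts ⇒ near direction `Function.update τ i 1 ∈ Linv p c` — verbatim the
  conclusion of `ConeExit`'s `stub_nearDirection` — and `dL c′ ≤ dL c`). `1 ≤ dL c` is derived here
  from the near direction (`one_le_dL_of_mem_Linv`, proved). The strategist's `stub_orderWindow` /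
  `stub_dLmono` are the composites `stepDict(a) + orderWindow` / `stepDict(b,c) + coneAlgebra`.
* `stub_wideRecurrent` ↦ `stub_wideEternal`: hypotheses `0 < r`, `∀ m, PairIso (run m) (run (m+r))`
  dropped (see above); still `⇐ WildCones.ConeExit` in one line.
* `stub_narrowRunsDie`, `stub_classicalRegimes`: unchanged (sibling cruxes BY NAME).
* (r3) `stub_unwind` is DISCHARGED modulo the named sub-statement `Transport` of crux `ClosingReduction`
  (landed `Theorems/FrobeniusClosingNoPeriodicIsolatedAtomUnwindOfTransport.lean`); `stub_transport : Transport`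
  joins the stubs BY NAME (its proof is a registered stub of crux 16347's line; kit + factorization landed there).

Registered stubs after r4: `stub_transport`, `stub_stepDict`, `stub_coneAlgebra`, `stub_narrowRunsDie`,
`stub_classicalRegimes` (the composition `NoPeriodicIsolatedAtom_of` needs only transport / narrow /
classical since `ConeExit` is a theorem; `stub_stepDict`, `stub_coneAlgebra` serve the ridge composition
`NoPeriodicIsolatedAtom_of_ridge`); sorries only in `stub_*`. Theorems-side base for the workers: `Theorems/ConeExit/Negative/Mirror.lean` (token-identical
mirror of `clean … dL`, landed p154980) — lemmas proved over it transfer here by `rfl`.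

Disproof used: `Cruxes/NoPeriodicIsolatedAtom/Disproof.lean` (cdisprove cycle 1): §2 hypothesis census
(`Isol`, `MultP`, `0 < r` load-bearing — `Negative/FalseWithoutIsol|FalseWithoutMultP|FalseWithoutRpos`
landed; `Isol` is consumed by `stub_orderWindow`, `stub_narrowRunsDie`, `stub_classicalRegimes`,
`stub_wideEternal`; `MultP` by every stub; `0 < r` by `stub_unwind`); §3 regime sketch = this cut
(3.0 unwind, 3.3 orderWindow, 3.4 rankStep/room, 3.5 wideEternal ⇐ ConeExit by Koszul, 3.6 narrow,
3.1/3.2/3.7 classical); §4: the refuted strengthenings "cone class never recurs" / "μ monotone" are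
not used; §5: no stub of `ridge_rank` judged false. Idea `Ideas/koszul-exit-and-suspension.md`: its
Lever 1 is the route to `stub_wideEternal` through `ConeExit` (owned by crux 16883's line).
-/

noncomputable section

-- single-problem summit: the doubled namespace component `ResolutionOfSingularities` is forced
set_option linter.dupNamespace false

open Summit.ResolutionOfSingularities.ResolutionOfSingularities.Theses.FrobeniusClosing (NoPeriodicIsolatedAtom)
open Summit.ResolutionOfSingularities.ResolutionOfSingularities.Theses.WildCones (NarrowRunsDie ClassicalRegimes ConeExit)

namespace Summit.ResolutionOfSingularities.ResolutionOfSingularities.Cruxes.NoPeriodicIsolatedAtom.Lines.RidgeRank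

open scoped BigOperators Classical

/-! ## The named dynamics (verbatim mirror of the two route files' common `let`-block; `p` = the
prime, states are coefficient functions `(Fin n → ℕ) → κ`) -/

/-- `p`-cleaning: delete the monomials all of whose exponents are divisible by `p`. Mirror of the
crux's `clean`. [cite: HauserPerlega2019, §2] -/
def clean (p : ℕ) {n : ℕ} {κ : Type} [Field κ] (c : (Fin n → ℕ) → κ) : (Fin n → ℕ) → κ :=
  fun A => @ite κ (∀ j, p ∣ A j) (Classical.dec _) 0 (c A)

/-- Total transform under the chart-`i` point blow-up `u_i ↦ u_i`, `u_j ↦ u_i u_j (j ≠ i)`.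
Mirror of the crux's `bl`. [cite: HauserPerlega2019, §2] -/
def bl {n : ℕ} {κ : Type} [Field κ] (i : Fin n) (c : (Fin n → ℕ) → κ) : (Fin n → ℕ) → κ :=
  fun B => @ite κ (Finset.sum (Finset.univ.erase i) (fun j => B j) ≤ B i) (Classical.dec _) (c (Function.update B i (B i - Finset.sum (Finset.univ.erase i) (fun j => B j)))) 0

/-- Order (least total degree of a non-zero coefficient; junk `0` at `0`). Mirror of the crux's
`ord`. [folklore] -/
def ord {n : ℕ} {κ : Type} [Field κ] (c : (Fin n → ℕ) → κ) : ℕ :=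
  sInf {m : ℕ | ∃ A, c A ≠ 0 ∧ m = Finset.sum Finset.univ (fun j => A j)}

/-- Division by `u_i ^ s`. Mirror of the crux's `dv`. [folklore] -/
def dv {n : ℕ} {κ : Type} [Field κ] (i : Fin n) (s : ℕ) (c : (Fin n → ℕ) → κ) : (Fin n → ℕ) → κ :=
  fun B => c (Function.update B i (B i + s))

/-- Translation `u_j ↦ u_j + τ_j (j ≠ i)` to the point `τ` of the exceptional divisor in chart `i`.
Mirror of the crux's `tr`. [folklore] -/
def tr {n : ℕ} {κ : Type} [Field κ] (i : Fin n) (τ : Fin n → κ) (s : ℕ) (c : (Fin n → ℕ) → κ) : (Fin n → ℕ) → κ :=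
  fun B => Finset.sum (Fintype.piFinset (fun _ : Fin n => Finset.range (B i + s + 1))) (fun D => @ite κ (D i = 0) (Classical.dec _) (c (B + D) * Finset.prod (Finset.univ.erase i) (fun j => ((Nat.choose (B j + D j) (B j) : ℕ) : κ) * τ j ^ (D j))) 0)

/-- ONE STEP of the point-blow-up dynamics (chart `i`, translation `τ`). Mirror of the crux's
`step`. [cite: HauserPerlega2019, §2] -/
def step (p : ℕ) {n : ℕ} {κ : Type} [Field κ] (i : Fin n) (τ : Fin n → κ) (c : (Fin n → ℕ) → κ) : (Fin n → ℕ) → κ :=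
  clean p (tr i τ (@ite ℕ (p ≤ ord (clean p c)) (Classical.dec _) p 0) (dv i (@ite ℕ (p ≤ ord (clean p c)) (Classical.dec _) p 0) (bl i (clean p c))))

/-- THE RUN `c_m` (`run 0 = c₀`, `run (m+1) = step (i m) (t m) (run m)` definitionally). Mirror of
the crux's `run`. [folklore] -/
def run (p : ℕ) {n : ℕ} {κ : Type} [Field κ] (c₀ : (Fin n → ℕ) → κ) (i : ℕ → Fin n) (t : ℕ → Fin n → κ) (m : ℕ) : (Fin n → ℕ) → κ :=
  @Nat.rec (fun _ => (Fin n → ℕ) → κ) c₀ (fun m c => step p (i m) (t m) c) m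

/-- The cleaned state as a formal power series. Mirror of the crux's `ser`. [folklore] -/
def ser (p : ℕ) {n : ℕ} {κ : Type} [Field κ] (c : (Fin n → ℕ) → κ) : MvPowerSeries (Fin n) κ :=
  show MvPowerSeries (Fin n) κ from fun A : Fin n →₀ ℕ => clean p c ⇑A

/-- Formal partial derivative `∂/∂u_i`. Mirror of the crux's `pd`. [folklore] -/
def pd {n : ℕ} {κ : Type} [Field κ] (i : Fin n) (f : MvPowerSeries (Fin n) κ) : MvPowerSeries (Fin n) κ :=
  show MvPowerSeries (Fin n) κ from fun A : Fin n →₀ ℕ => ((A i + 1 : ℕ) : κ) * f (A + Finsupp.single i 1)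

/-- Jacobian ideal `(∂₁a, …, ∂ₙa)` of the cleaned state. Mirror of the crux's `jac`.
[cite: BoubakriGreuelMarkwig2010, §1] -/
def jac (p : ℕ) {n : ℕ} {κ : Type} [Field κ] (c : (Fin n → ℕ) → κ) : Ideal (MvPowerSeries (Fin n) κ) :=
  Ideal.span (Set.range (fun i => pd i (ser p c)))

/-- ISOLATED: the Milnor-type algebra `κ[[u]]/(∂a)` is finite over `κ`. Mirror of the crux's
`Isol`. [cite: BoubakriGreuelMarkwig2010, §1] -/
def Isol (p : ℕ) {n : ℕ} {κ : Type} [Field κ] (c : (Fin n → ℕ) → κ) : Prop :=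
  Module.Finite κ (MvPowerSeries (Fin n) κ ⧸ jac p c)

/-- MULTIPLICITY `p`: the cleaned state is non-zero and all its monomials have degree `≥ p`.
Mirror of the crux's `MultP`. [cite: HauserPerlega2019, §2] -/
def MultP (p : ℕ) {n : ℕ} {κ : Type} [Field κ] (c : (Fin n → ℕ) → κ) : Prop :=
  (∃ A, clean p c A ≠ 0) ∧ ∀ A, clean p c A ≠ 0 → p ≤ Finset.sum Finset.univ (fun j => A j)

/-- PAIR ISOMORPHISM `(κ[[u]], [a]) ≅ (κ[[u]], [a'])`: `φ(a) = v^p·a' + g^p`. Mirror of the crux's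
`PairIso`. [cite: HauserPerlega2019, §1 and §4] -/
def PairIso (p : ℕ) {n : ℕ} {κ : Type} [Field κ] (c c' : (Fin n → ℕ) → κ) : Prop :=
  ∃ (φ : MvPowerSeries (Fin n) κ ≃ₐ[κ] MvPowerSeries (Fin n) κ) (v g : MvPowerSeries (Fin n) κ), IsUnit v ∧ φ (ser p c) = v ^ p * ser p c' + g ^ p

/-- ON THE RIDGE: the cleaned state has a monomial of degree exactly `p`. Mirror of
`WildCones`' `OrdP`. [cite: CossartJannsenSaito2020, §1 p. 13 (ridge)] -/
def OrdP (p : ℕ) {n : ℕ} {κ : Type} [Field κ] (c : (Fin n → ℕ) → κ) : Prop :=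
  ∃ A, clean p c A ≠ 0 ∧ Finset.sum Finset.univ (fun j => A j) = p

/-- THE TANGENT CONE: the degree-`p` part `a_p` of the cleaned state, as a polynomial. Mirror of
`WildCones`' `cone`. [cite: CossartJannsenSaito2020, Def. 2.8] -/
def cone (p : ℕ) {n : ℕ} {κ : Type} [Field κ] (c : (Fin n → ℕ) → κ) : MvPolynomial (Fin n) κ :=
  Finset.sum (Fintype.piFinset (fun _ : Fin n => Finset.range (p + 1))) (fun A => @ite (MvPolynomial (Fin n) κ) (Finset.sum Finset.univ (fun j => A j) = p) (Classical.dec _) (MvPolynomial.monomial (Finsupp.equivFunOnFinite.symm A) (clean p c A)) 0)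

/-- THE ADDITIVE-INVARIANCE SPACE `L(a_p) = {w | a_p(X + w S) = a_p(X) + a_p(w) S^p}` of the cone
(a polynomial identity in a fresh variable `S = X none`). Mirror of `WildCones`' `Linv`.
[cite: Hironaka1970AdditiveGroups; CossartJannsenSaito2020, §1 p. 13] -/
def Linv (p : ℕ) {n : ℕ} {κ : Type} [Field κ] (c : (Fin n → ℕ) → κ) : Set (Fin n → κ) :=
  {w : Fin n → κ | MvPolynomial.aeval (fun j : Fin n => (MvPolynomial.X (some j) : MvPolynomial (Option (Fin n)) κ) + MvPolynomial.C (w j) * MvPolynomial.X none) (cone p c) = MvPolynomial.rename some (cone p c) + MvPolynomial.C (MvPolynomial.eval w (cone p c)) * (MvPolynomial.X none) ^ p}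

/-- THE INVARIANCE RANK `dL = dim span L(a_p)`. Mirror of `WildCones`' `dL`.
[cite: Hironaka1970AdditiveGroups] -/
def dL (p : ℕ) {n : ℕ} {κ : Type} [Field κ] (c : (Fin n → ℕ) → κ) : ℕ :=
  Module.finrank κ (Submodule.span κ (Linv p c))

/-! ## The three route decls over the named dynamics, and the exactness of the mirror -/

/-- The crux `FrobeniusClosing.NoPeriodicIsolatedAtom` over the named dynamics (same binders, same
order). [cite: HauserPerlega2019, §1 p. 3] -/
def NamedNP : Prop :=
  ∀ p : ℕ, p.Prime → ∀ n : ℕ, 0 < n → ∀ (κ : Type) [Field κ] [Algebra (ZMod p) κ] [Algebra.IsAlgebraic (ZMod p) κ]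
    (c₀ : (Fin n → ℕ) → κ) (i : ℕ → Fin n) (t : ℕ → Fin n → κ) (r : ℕ), 0 < r →
    (∀ m, m ≤ r → Isol p (run p c₀ i t m) ∧ MultP p (run p c₀ i t m)) →
    ¬ PairIso p (run p c₀ i t 0) (run p c₀ i t r)

/-- **The mirror is exact for the crux**: `NoPeriodicIsolatedAtom` and `NamedNP` are the same
proposition definitionally (the `let`-block ζ-reduces onto the `def`s). [folklore] -/
theorem namedNP_iff : NoPeriodicIsolatedAtom ↔ NamedNP := Iff.rfl

/-- The sibling crux `WildCones.NarrowRunsDie` over the named dynamics. [cite: CossartJannsenSaito2020, Cor. 6.37] -/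
def NamedNRD : Prop :=
  ∀ p : ℕ, p.Prime → p ≠ 2 → ∀ n : ℕ, 3 ≤ n → ∀ (κ : Type) [Field κ] [CharP κ p] [PerfectField κ]
    (c₀ : (Fin n → ℕ) → κ) (i : ℕ → Fin n) (t : ℕ → Fin n → κ),
    (∀ m, Isol p (run p c₀ i t m) ∧ MultP p (run p c₀ i t m)) →
    (∀ m, OrdP p (run p c₀ i t m) ∧ dL p (run p c₀ i t m) = 1) → False

/-- **The mirror is exact for `NarrowRunsDie`** (WildCones' `let`-block extends FrobeniusClosing's
by `OrdP, cone, Linv, dL`, mirrored above). [folklore] -/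
theorem namedNRD_iff : NarrowRunsDie ↔ NamedNRD := Iff.rfl

/-- The sibling crux `WildCones.ClassicalRegimes` over the named dynamics. [cite: Lipman1978; Liu2002, Thm. 8.3.44] -/
def NamedCR : Prop :=
  ∀ p : ℕ, p.Prime → ∀ n : ℕ, 0 < n → (n ≤ 2 ∨ p = 2) → ∀ (κ : Type) [Field κ] [CharP κ p] [PerfectField κ]
    (c₀ : (Fin n → ℕ) → κ) (i : ℕ → Fin n) (t : ℕ → Fin n → κ),
    ¬ (∀ m, Isol p (run p c₀ i t m) ∧ MultP p (run p c₀ i t m))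

/-- **The mirror is exact for `ClassicalRegimes`**. [folklore] -/
theorem namedCR_iff : ClassicalRegimes ↔ NamedCR := Iff.rfl

/-- The sibling one-step crux `WildCones.ConeExit` over the named dynamics (used only to CERTIFY the
transfer edge `wideRecurrent_of_coneExit`; it is NOT a stub of this line). [cite: doi:10.1007/BFb0063393, Ch. 1] -/
def NamedCE : Prop :=
  ∀ p : ℕ, p.Prime → p ≠ 2 → ∀ n : ℕ, 3 ≤ n → ∀ (κ : Type) [Field κ] [CharP κ p] [PerfectField κ]
    (c : (Fin n → ℕ) → κ) (i : Fin n) (τ : Fin n → κ),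
    Isol p c → MultP p c → Isol p (step p i τ c) → MultP p (step p i τ c) → OrdP p c ∧ dL p c = 1

/-- **The mirror is exact for `ConeExit`**. [folklore] -/
theorem namedCE_iff : ConeExit ↔ NamedCE := Iff.rfl

/-! ## The stub STATEMENTS by name (`Sig.stub_<name>`; the composition takes exactly these, plus
the two sibling cruxes by their route names) -/

/-- Statement of `stub_unwind` — **UNWINDING** (periodic ⇒ eternal): a periodic isolated
multiplicity-`p` chain over a field `κ` algebraic over `𝔽_p` makes `κ` a perfect field of
characteristic `p` carrying an ETERNAL chain all of whose states are isolated of multiplicity `p`.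
Content: SUCCESSOR EQUIVARIANCE — if `φ(a) = v^p·a' + g^p` with `φ` a substitution endomorphism of
`κ[[u]]` with invertible linear part `A`, `v` a unit, then for every chart/translation `(i, τ)` on the
`a`-side there is `(i', τ')` on the `a'`-side (the `κ`-point `A⁻¹(e_i + τ)` of the exceptional
`ℙ^{n-1}`) and `φ', v', g'` of the same kind with `φ'(a⁺) = v'^p·a'⁺ + g'^p` (`φ' = σ⁻¹ ∘ φ ∘ σ'`,
`u_{i'}` divides `φ(σ'(u))`); `Isol` (`jac (φ a) = φ(jac a)·R ⊇ 𝔪^N`) and `MultP` (the lowest form of a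
cleaned series is not a Frobenius form, and `g^p`, `∂(g^p) = 0`, only carries Frobenius monomials)
pass from the `a`-side to the `a'`-side; iterate from the given pair isomorphism `run 0 → run r`
(recursion on `m`, choice). `Algebra (ZMod p) κ` gives `CharP κ p`; algebraic over the perfect
field `𝔽_p` gives `PerfectField κ`. [cite: HauserPerlega2019, §1 p. 3; BoubakriGreuelMarkwig2010, §1] -/
def Sig.stub_unwind : Prop :=
  ∀ p : ℕ, p.Prime → ∀ n : ℕ, 0 < n → ∀ (κ : Type) [Field κ] [Algebra (ZMod p) κ] [Algebra.IsAlgebraic (ZMod p) κ]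
    (c₀ : (Fin n → ℕ) → κ) (i : ℕ → Fin n) (t : ℕ → Fin n → κ) (r : ℕ), 0 < r →
    (∀ m, m ≤ r → Module.Finite κ (MvPowerSeries (Fin n) κ ⧸ jac p (run p c₀ i t m)) ∧
      ((∃ A, clean p (run p c₀ i t m) A ≠ 0) ∧ ∀ A, clean p (run p c₀ i t m) A ≠ 0 → p ≤ Finset.sum Finset.univ (fun j => A j))) →
    (∃ (φ : MvPowerSeries (Fin n) κ ≃ₐ[κ] MvPowerSeries (Fin n) κ) (v g : MvPowerSeries (Fin n) κ),
        IsUnit v ∧ φ (ser p (run p c₀ i t 0)) = v ^ p * ser p (run p c₀ i t r) + g ^ p) →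
    ∃ (_ : CharP κ p) (_ : PerfectField κ) (c₀' : (Fin n → ℕ) → κ) (i' : ℕ → Fin n) (t' : ℕ → Fin n → κ),
      ∀ m, Module.Finite κ (MvPowerSeries (Fin n) κ ⧸ jac p (run p c₀' i' t' m)) ∧
        ((∃ A, clean p (run p c₀' i' t' m) A ≠ 0) ∧ ∀ A, clean p (run p c₀' i' t' m) A ≠ 0 → p ≤ Finset.sum Finset.univ (fun j => A j))

/-- Statement of `stub_stepDict` — **THE STEP DICTIONARY** (the only stub that opens `bl/dv/tr/clean`):
for a state `c` of multiplicity `p` (so the step divides by `u_i^p` exactly), chart `i`, translation `τ`: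
(a) if `c` has NO cleaned monomial of degree exactly `p`, every coefficient of the successor at an
exponent `B` with `B i = 0` vanishes (`u_i ∣ a⁺`: the coefficient is a sum of `clean c A · binomials · τ^D`
over `|A| = p`); (b) the `u_i`-free degree-`p` coefficients are UNCHANGED by the step (only `D = 0`
survives the blow-up guard); (c) if moreover the successor has multiplicity `p`, its `u_i`-free
coefficients in degrees `1 … p−1` vanish, which — by the homogeneous Taylor formula for
`X_j ↦ X_j + τ_j X_i` — is the CONE SHAPE identity
`a_p(X_i, X′ + τ X_i) = a_p(e_i + τ)·X_i^p + a_p(0, X′)` for the tangent cone `a_p = cone p c`.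
[cite: HauserPerlega2019, §2; CossartJannsenSaito2020, Thm. 3.14] -/
def Sig.stub_stepDict : Prop :=
  ∀ p : ℕ, p.Prime → ∀ (n : ℕ) (κ : Type) [Field κ] (c : (Fin n → ℕ) → κ) (i : Fin n) (τ : Fin n → κ),
    ((∃ A, clean p c A ≠ 0) ∧ ∀ A, clean p c A ≠ 0 → p ≤ Finset.sum Finset.univ (fun j => A j)) →
    ((∀ A, clean p c A ≠ 0 → Finset.sum Finset.univ (fun j => A j) ≠ p) →
        ∀ B : Fin n → ℕ, B i = 0 → clean p (step p i τ c) B = 0) ∧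
    (∀ A : Fin n → ℕ, A i = 0 → Finset.sum Finset.univ (fun j => A j) = p →
        clean p (step p i τ c) A = clean p c A) ∧
    (((∃ A, clean p (step p i τ c) A ≠ 0) ∧ ∀ A, clean p (step p i τ c) A ≠ 0 → p ≤ Finset.sum Finset.univ (fun j => A j)) →
        MvPolynomial.aeval (fun j : Fin n => if j = i then MvPolynomial.X i
            else MvPolynomial.X j + MvPolynomial.C (τ j) * MvPolynomial.X i) (cone p c) =
          MvPolynomial.C (MvPolynomial.eval (Function.update τ i 1) (cone p c)) * MvPolynomial.X i ^ p +
            MvPolynomial.aeval (fun j : Fin n => if j = i then 0 else MvPolynomial.X j) (cone p c))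

/-- Statement of `stub_orderWindow` — **THE RIDGE ARENA, algebraic half** (with `stub_stepDict` (a)
this is the strategist's order-window lemma): in dimension `n ≥ 3`, over any field, a coefficient
function `c′` whose cleaned series is divisible by `u_i` (all coefficients at `B` with `B i = 0` vanish)
cannot be isolated of multiplicity `p`: `a′ = u_i·q`, multiplicity `p` kills the monomial `u_i` so
`q(0) = 0`, `(∂a′) ⊆ (u_i, q)`, and `K[[u]]/(u_i, q)` is infinite over `K` for `n − 1 ≥ 2` remaining
variables (`u_j^a, u_k^b ∈ (u_i, q)` ⇒ `q|_{u_i=0}` divides `u_j^a` and `u_k^b` ⇒ unit).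
[cite: HauserPerlega2019, §2–§3; BoubakriGreuelMarkwig2010, §1] -/
def Sig.stub_orderWindow : Prop :=
  ∀ p : ℕ, p.Prime → ∀ n : ℕ, 3 ≤ n → ∀ (K : Type) [Field K] (c' : (Fin n → ℕ) → K) (i : Fin n),
    (∀ B : Fin n → ℕ, B i = 0 → clean p c' B = 0) →
    Module.Finite K (MvPowerSeries (Fin n) K ⧸ jac p c') →
    ((∃ A, clean p c' A ≠ 0) ∧ ∀ A, clean p c' A ≠ 0 → p ≤ Finset.sum Finset.univ (fun j => A j)) → False

/-- Statement of `stub_coneAlgebra` — **CONE ALGEBRA** (ROOM; near direction and rank drop from the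
cone shape). (1) ROOM: a ridge state has `dL c + 2 ≤ n` — `L = Linv` is a subspace; if it contains
`n − 1` independent vectors, complete to a basis and substitute `X ↦ Σ_k Y_k b_k`: iterating the
defining identity (and homogeneity on the last direction) makes `a_p` a FROBENIUS FORM `Σ β_k Y_k^p`,
hence `Σ γ_j X_j^p` in the original coordinates (characteristic `p`), but `cone c` carries only cleaned
monomials, so `cone c = 0`, contradicting `OrdP c`. (2) Given the cone shape
`a_p(X_i, X′+τX_i) = e·X_i^p + G̃(X′)` (`G̃ = a_p|_{X_i=0}`, `e = a_p(e_i+τ)`) and a second coefficient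
function `c′` with the same `u_i`-free degree-`p` coefficients: `(X_i+S)^p = X_i^p + S^p` gives the near
direction `e_i + τ ∈ L(a_p)`; `L(cone c′) ∩ {w_i = 0} ⊆ L(G̃) ∩ {w_i = 0} ⊆ L(a_p)` and a hyperplane
costs at most one dimension, so `dL c′ ≤ dL c`.
[cite: Hironaka1970AdditiveGroups; CossartJannsenSaito2020, Thm. 3.14] -/
def Sig.stub_coneAlgebra : Prop :=
  (∀ p : ℕ, p.Prime → ∀ (n : ℕ) (κ : Type) [Field κ] [CharP κ p] (c : (Fin n → ℕ) → κ),
      (∃ A, clean p c A ≠ 0 ∧ Finset.sum Finset.univ (fun j => A j) = p) → dL p c + 2 ≤ n) ∧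
    (∀ p : ℕ, p.Prime → ∀ (n : ℕ) (κ : Type) [Field κ] [CharP κ p] (c c' : (Fin n → ℕ) → κ) (i : Fin n) (τ : Fin n → κ),
      MvPolynomial.aeval (fun j : Fin n => if j = i then MvPolynomial.X i
          else MvPolynomial.X j + MvPolynomial.C (τ j) * MvPolynomial.X i) (cone p c) =
        MvPolynomial.C (MvPolynomial.eval (Function.update τ i 1) (cone p c)) * MvPolynomial.X i ^ p +
          MvPolynomial.aeval (fun j : Fin n => if j = i then 0 else MvPolynomial.X j) (cone p c) →
      (∀ A : Fin n → ℕ, A i = 0 → Finset.sum Finset.univ (fun j => A j) = p → clean p c' A = clean p c A) →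
      Function.update τ i 1 ∈ Linv p c ∧ dL p c' ≤ dL p c)

/-- Statement of `stub_wideEternal` — **NO ETERNAL WIDE RIDGE CHAIN OF CONSTANT RANK** (OPEN,
load-bearing; `⇐ WildCones.ConeExit`): for `p` odd, `n ≥ 4` and `κ` algebraic over `𝔽_p` (perfect,
characteristic `p`), there is no eternal chain of isolated multiplicity-`p` states all of which lie
on the ridge with the SAME invariance rank `d ≥ 2`.
[cite: HauserPerlega2019, §1 p. 3 and §5; doi:10.1007/BFb0063393] -/
def Sig.stub_wideEternal : Prop :=
  ∀ p : ℕ, p.Prime → p ≠ 2 → ∀ n : ℕ, 4 ≤ n → ∀ (κ : Type) [Field κ] [CharP κ p] [PerfectField κ]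
    [Algebra (ZMod p) κ] [Algebra.IsAlgebraic (ZMod p) κ]
    (c₀ : (Fin n → ℕ) → κ) (i : ℕ → Fin n) (t : ℕ → Fin n → κ) (d : ℕ), 2 ≤ d →
    (∀ m, Module.Finite κ (MvPowerSeries (Fin n) κ ⧸ jac p (run p c₀ i t m)) ∧
      ((∃ A, clean p (run p c₀ i t m) A ≠ 0) ∧ ∀ A, clean p (run p c₀ i t m) A ≠ 0 → p ≤ Finset.sum Finset.univ (fun j => A j))) →
    (∀ m, (∃ A, clean p (run p c₀ i t m) A ≠ 0 ∧ Finset.sum Finset.univ (fun j => A j) = p) ∧ dL p (run p c₀ i t m) = d) → False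

/-! ## The stubs -/

/-- **STUB `stub_transport` — DISCHARGED** (= the named sub-statement `Transport` of crux `ClosingReduction`
(stmt-ResolutionOfSingularities-16347), line `chart-factorization`; LANDED there 2026-08-17 as
`Theorems/FrobeniusClosingClosingReductionTransport.lean`, `stub_transport : PairIsoKit → Transport`, with
`stub_pairIsoKit` landed too): TRANSPORT OF SUCCESSOR POINTS along a pair isomorphism over a
perfect field of characteristic `p` — if `PairIso c c'` and `c` has multiplicity `p`, every successor
`step i τ c` is pair-isomorphic to some successor `step i' τ' c'`. [cite: HauserPerlega2019, §1 p. 3] -/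
theorem stub_transport : Summit.ResolutionOfSingularities.ResolutionOfSingularities.Theorems.FrobeniusClosing.Transport :=
  Summit.ResolutionOfSingularities.ResolutionOfSingularities.Theorems.FrobeniusClosing.stub_transport Summit.ResolutionOfSingularities.ResolutionOfSingularities.Theorems.FrobeniusClosing.stub_pairIsoKit

/-- **STUB `stub_unwind` — DISCHARGED modulo `stub_transport`** (LANDED as
`Theorems/FrobeniusClosingNoPeriodicIsolatedAtomUnwindOfTransport.lean`, `unwind_of_transport`, lead):
unwinding a periodic chain to an eternal one (stagewise transport of the move made `r` steps earlier,
`Isol`/`MultP` by the landed pair-isomorphism kit, diagonal of the stabilising extensions, instances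
`CharP`/`PerfectField` from algebraicity over `ZMod p`). The two namings of the dynamics
(`Theorems.FrobeniusClosing.run/Isol/MultP/PairIso` and this file's) agree definitionally.
[cite: HauserPerlega2019, §1 p. 3; BoubakriGreuelMarkwig2010, §1] -/
theorem stub_unwind :
    ∀ p : ℕ, p.Prime → ∀ n : ℕ, 0 < n → ∀ (κ : Type) [Field κ] [Algebra (ZMod p) κ] [Algebra.IsAlgebraic (ZMod p) κ]
    (c₀ : (Fin n → ℕ) → κ) (i : ℕ → Fin n) (t : ℕ → Fin n → κ) (r : ℕ), 0 < r →
    (∀ m, m ≤ r → Module.Finite κ (MvPowerSeries (Fin n) κ ⧸ jac p (run p c₀ i t m)) ∧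
      ((∃ A, clean p (run p c₀ i t m) A ≠ 0) ∧ ∀ A, clean p (run p c₀ i t m) A ≠ 0 → p ≤ Finset.sum Finset.univ (fun j => A j))) →
    (∃ (φ : MvPowerSeries (Fin n) κ ≃ₐ[κ] MvPowerSeries (Fin n) κ) (v g : MvPowerSeries (Fin n) κ),
        IsUnit v ∧ φ (ser p (run p c₀ i t 0)) = v ^ p * ser p (run p c₀ i t r) + g ^ p) →
    ∃ (_ : CharP κ p) (_ : PerfectField κ) (c₀' : (Fin n → ℕ) → κ) (i' : ℕ → Fin n) (t' : ℕ → Fin n → κ),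
      ∀ m, Module.Finite κ (MvPowerSeries (Fin n) κ ⧸ jac p (run p c₀' i' t' m)) ∧
        ((∃ A, clean p (run p c₀' i' t' m) A ≠ 0) ∧ ∀ A, clean p (run p c₀' i' t' m) A ≠ 0 → p ≤ Finset.sum Finset.univ (fun j => A j)) :=
  fun p hp n hn κ _ _ _ c₀ i t r hr hchain hiso =>
    Summit.ResolutionOfSingularities.ResolutionOfSingularities.Theorems.FrobeniusClosing.unwind_of_transport stub_transport p hp n hn κ c₀ i t r hr hchain hiso

/-- **STUB `stub_stepDict` — LANDED p169238 (worker W1) — the step dictionary** (three coefficient identities of one step;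
Theorems-side theorem of the same name and signature over the token-identical mirror). [cite: HauserPerlega2019, §2] -/
theorem stub_stepDict :
    ∀ p : ℕ, p.Prime → ∀ (n : ℕ) (κ : Type) [Field κ] (c : (Fin n → ℕ) → κ) (i : Fin n) (τ : Fin n → κ),
    ((∃ A, clean p c A ≠ 0) ∧ ∀ A, clean p c A ≠ 0 → p ≤ Finset.sum Finset.univ (fun j => A j)) →
    ((∀ A, clean p c A ≠ 0 → Finset.sum Finset.univ (fun j => A j) ≠ p) →
        ∀ B : Fin n → ℕ, B i = 0 → clean p (step p i τ c) B = 0) ∧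
    (∀ A : Fin n → ℕ, A i = 0 → Finset.sum Finset.univ (fun j => A j) = p →
        clean p (step p i τ c) A = clean p c A) ∧
    (((∃ A, clean p (step p i τ c) A ≠ 0) ∧ ∀ A, clean p (step p i τ c) A ≠ 0 → p ≤ Finset.sum Finset.univ (fun j => A j)) →
        MvPolynomial.aeval (fun j : Fin n => if j = i then MvPolynomial.X i
            else MvPolynomial.X j + MvPolynomial.C (τ j) * MvPolynomial.X i) (cone p c) =
          MvPolynomial.C (MvPolynomial.eval (Function.update τ i 1) (cone p c)) * MvPolynomial.X i ^ p +
            MvPolynomial.aeval (fun j : Fin n => if j = i then 0 else MvPolynomial.X j) (cone p c)) :=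
  fun p hp n κ _ c i τ hM =>
    Summit.ResolutionOfSingularities.ResolutionOfSingularities.Theorems.NoPeriodicIsolatedAtom.RidgeRank.stub_stepDict
      p hp n κ c i τ hM

/-- **STUB (LANDED p167131, worker W2) — the ridge arena, algebraic half** (`u_i ∣ a′` is incompatible
with `Isol ∧ MultP` for `n ≥ 3`); discharged by the Theorems-side theorem of the same name and
signature over the token-identical mirror. [cite: BoubakriGreuelMarkwig2010, §1] -/
theorem stub_orderWindow :
    ∀ p : ℕ, p.Prime → ∀ n : ℕ, 3 ≤ n → ∀ (K : Type) [Field K] (c' : (Fin n → ℕ) → K) (i : Fin n),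
    (∀ B : Fin n → ℕ, B i = 0 → clean p c' B = 0) →
    Module.Finite K (MvPowerSeries (Fin n) K ⧸ jac p c') →
    ((∃ A, clean p c' A ≠ 0) ∧ ∀ A, clean p c' A ≠ 0 → p ≤ Finset.sum Finset.univ (fun j => A j)) → False :=
  fun p hp n hn K _ c' i h1 h2 h3 =>
    Summit.ResolutionOfSingularities.ResolutionOfSingularities.Theorems.NoPeriodicIsolatedAtom.RidgeRank.stub_orderWindow
      p hp n hn K c' i h1 h2 h3

/-- **STUB `stub_coneAlgebra` — LANDED p169347 (worker W3) — cone algebra** (ROOM; near direction; rank drop;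
Theorems-side theorem of the same name and signature). [cite: Hironaka1970AdditiveGroups; CossartJannsenSaito2020, Thm. 3.14] -/
theorem stub_coneAlgebra :
    (∀ p : ℕ, p.Prime → ∀ (n : ℕ) (κ : Type) [Field κ] [CharP κ p] (c : (Fin n → ℕ) → κ),
      (∃ A, clean p c A ≠ 0 ∧ Finset.sum Finset.univ (fun j => A j) = p) → dL p c + 2 ≤ n) ∧
    (∀ p : ℕ, p.Prime → ∀ (n : ℕ) (κ : Type) [Field κ] [CharP κ p] (c c' : (Fin n → ℕ) → κ) (i : Fin n) (τ : Fin n → κ),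
      MvPolynomial.aeval (fun j : Fin n => if j = i then MvPolynomial.X i
          else MvPolynomial.X j + MvPolynomial.C (τ j) * MvPolynomial.X i) (cone p c) =
        MvPolynomial.C (MvPolynomial.eval (Function.update τ i 1) (cone p c)) * MvPolynomial.X i ^ p +
          MvPolynomial.aeval (fun j : Fin n => if j = i then 0 else MvPolynomial.X j) (cone p c) →
      (∀ A : Fin n → ℕ, A i = 0 → Finset.sum Finset.univ (fun j => A j) = p → clean p c' A = clean p c A) →
      Function.update τ i 1 ∈ Linv p c ∧ dL p c' ≤ dL p c) :=
  Summit.ResolutionOfSingularities.ResolutionOfSingularities.Theorems.NoPeriodicIsolatedAtom.RidgeRank.stub_coneAlgebra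

/-- **STUB `stub_narrowRunsDie` — DISCHARGED** (sibling crux stmt-ResolutionOfSingularities-16882 CLOSED
2026-08-17: `Theorems/WildConesNarrowRunsDie.lean`, `NarrowRunsDie_proof`, line `derivlift`).
[cite: CossartJannsenSaito2020, Cor. 6.37] -/
theorem stub_narrowRunsDie : NarrowRunsDie :=
  Summit.ResolutionOfSingularities.ResolutionOfSingularities.Theorems.NarrowRunsDie_proof

/-- **STUB (= sibling crux stmt-ResolutionOfSingularities-16884, BY NAME) — classical regimes
`n ≤ 2 ∨ p = 2`.** [cite: Lipman1978; Liu2002, Thm. 8.3.44] -/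
theorem stub_classicalRegimes : ClassicalRegimes := by
  sorry

/-! ## Proved glue: eventual constancy, tails of runs, `1 ≤ dL` from a near direction -/

/-- A non-increasing `ℕ`-valued sequence is eventually constant. [folklore] -/
theorem eventually_const_of_antitone (f : ℕ → ℕ) (hstep : ∀ m, f (m + 1) ≤ f m) :
    ∃ M, ∀ m, f (M + m) = f M := by
  have hanti : ∀ M m, f (M + m) ≤ f M := by
    intro M m
    induction m with
    | zero => simp
    | succ k ih => exact le_trans (by simpa [Nat.add_assoc] using hstep (M + k)) ih
  have hne : (Set.range f).Nonempty := ⟨f 0, 0, rfl⟩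
  obtain ⟨M, hM⟩ : sInf (Set.range f) ∈ Set.range f := Nat.sInf_mem hne
  refine ⟨M, fun m => le_antisymm (hanti M m) ?_⟩
  rw [hM]
  exact Nat.sInf_le ⟨M + m, rfl⟩

/-- **A tail of a run is a run**: `run c₀ i t (M + m)` is the run started at `run c₀ i t M` along the
shifted words (definitional unfolding of `Nat.rec`). [folklore] -/
theorem run_add (p : ℕ) {n : ℕ} {κ : Type} [Field κ] (c₀ : (Fin n → ℕ) → κ) (i : ℕ → Fin n)
    (t : ℕ → Fin n → κ) (M m : ℕ) :
    run p c₀ i t (M + m) = run p (run p c₀ i t M) (fun k => i (M + k)) (fun k => t (M + k)) m := by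
  induction m with
  | zero => rfl
  | succ m ih =>
    show step p (i (M + m)) (t (M + m)) (run p c₀ i t (M + m)) =
      step p (i (M + m)) (t (M + m)) (run p (run p c₀ i t M) (fun k => i (M + k)) (fun k => t (M + k)) m)
    rw [ih]

/-- A non-zero vector of `Linv` gives `1 ≤ dL`. [folklore] -/
theorem one_le_dL_of_mem_Linv (p : ℕ) {n : ℕ} {κ : Type} [Field κ] (c : (Fin n → ℕ) → κ)
    (v : Fin n → κ) (hv : v ∈ Linv p c) (hv0 : v ≠ 0) : 1 ≤ dL p c := by
  unfold dL
  by_contra h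
  have h0 : Module.finrank κ (Submodule.span κ (Linv p c)) = 0 := by omega
  rw [Submodule.finrank_eq_zero] at h0
  have hmem : v ∈ Submodule.span κ (Linv p c) := Submodule.subset_span hv
  rw [h0, Submodule.mem_bot] at hmem
  exact hv0 hmem

/-! ## The transfer edge (proved): the sibling route's one-step crux closes the open stub -/

/-- **`WildCones.ConeExit` ⇒ `stub_wideEternal`** in one step: on an eternal chain, `ConeExit` at
`m = 0` gives `dL (run 0) = 1`, contradicting the constant rank `d ≥ 2`. So the WildCones engine
(`ConeExit ∧ NarrowRunsDie ∧ ClassicalRegimes`) closes this line modulo the four TRUE stubs.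
[cite: doi:10.1007/BFb0063393, Ch. 1] -/
theorem wideEternal_of_coneExit : ConeExit → Sig.stub_wideEternal := by
  intro hCE p hp hp2 n hn κ _ _ _ _ _ c₀ i t d hd hall hridge
  have h := (namedCE_iff.mp hCE) p hp hp2 n (by omega) κ (run p c₀ i t 0) (i 0) (t 0)
    (hall 0).1 (hall 0).2 (hall 1).1 (hall 1).2
  have h0 := (hridge 0).2
  omega

/-- **`WildCones.ConeExit` IS A THEOREM** (crux stmt-ResolutionOfSingularities-16883 CLOSED 2026-08-17:
`Theorems/WildConesConeExit.lean`, `ConeExit_proof`, line `critical-plane`). [cite: doi:10.1007/BFb0063393, Ch. 1] -/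
theorem coneExit_holds : ConeExit :=
  Summit.ResolutionOfSingularities.ResolutionOfSingularities.Theorems.WildConesConeExit.ConeExit_proof

/-- **STUB `stub_wideEternal` — DISCHARGED** by the landed `ConeExit` through the transfer edge.
[cite: HauserPerlega2019, §1 p. 3, §5] -/
theorem stub_wideEternal : Sig.stub_wideEternal :=
  wideEternal_of_coneExit coneExit_holds

/-! ## The composition (kernel-checked; no `sorry` in its own term) -/

/-- **`NoPeriodicIsolatedAtom` from the three open stubs** — THE ASSEMBLY, PROVED (reshape r4, after
`WildCones.ConeExit` became a theorem): unwind the periodic chain to an eternal one over the same (now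
perfect, characteristic-`p`) field (`unwind_of_transport`, landed, fed with `Transport`);
`n ≤ 2 ∨ p = 2` contradicts `ClassicalRegimes`; otherwise `ConeExit` at every step of the eternal
chain gives `OrdP ∧ dL = 1` for every state, which is exactly the hypothesis of `NarrowRunsDie`.
The conclusion is the route decl by name, through `namedNP_iff`. [cite: HauserPerlega2019, §1 p. 3] -/
theorem NoPeriodicIsolatedAtom_of :
    ClassicalRegimes → NoPeriodicIsolatedAtom := by
  intro hC
  have hN : NarrowRunsDie := stub_narrowRunsDie
  have hT : Summit.ResolutionOfSingularities.ResolutionOfSingularities.Theorems.FrobeniusClosing.Transport := stub_transport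
  refine namedNP_iff.mpr ?_
  intro p hp n hn κ _ _ _ c₀ i t r hr hchain hiso
  have hU : Sig.stub_unwind := fun p hp n hn κ _ _ _ c₀ i t r hr hchain hiso =>
    Summit.ResolutionOfSingularities.ResolutionOfSingularities.Theorems.FrobeniusClosing.unwind_of_transport hT p hp n hn κ c₀ i t r hr hchain hiso
  obtain ⟨hchar, hperf, c₁, i₁, t₁, hall₁⟩ := hU p hp n hn κ c₀ i t r hr hchain hiso
  haveI : CharP κ p := hchar
  haveI : PerfectField κ := hperf
  by_cases hcl : n ≤ 2 ∨ p = 2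
  · exact (namedCR_iff.mp hC) p hp n hn hcl κ c₁ i₁ t₁ hall₁
  · have hn3 : 3 ≤ n := by
      rcases Nat.lt_or_ge n 3 with h | h
      · exact absurd (Or.inl (by omega)) hcl
      · exact h
    have hp2 : p ≠ 2 := fun h => hcl (Or.inr h)
    -- `ConeExit` at every step: every state is on the ridge with invariance rank 1
    have hCE : ∀ m, OrdP p (run p c₁ i₁ t₁ m) ∧ dL p (run p c₁ i₁ t₁ m) = 1 := fun m =>
      (namedCE_iff.mp coneExit_holds) p hp hp2 n hn3 κ (run p c₁ i₁ t₁ m) (i₁ m) (t₁ m)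
        (hall₁ m).1 (hall₁ m).2 (hall₁ (m + 1)).1 (hall₁ (m + 1)).2
    exact (namedNRD_iff.mp hN) p hp hp2 n hn3 κ c₁ i₁ t₁ hall₁ hCE

/-- **The ridge-rank composition** (the line's original mechanism, reshape r2/r3; kept because it is
what the landed / in-flight stubs `stub_stepDict`, `stub_orderWindow`, `stub_coneAlgebra` serve, and
because it needs `ConeExit` only through the weaker `stub_wideEternal`): unwind; classical regimes;
otherwise ridge at every state, near direction, rank drop, ROOM, eventual constancy of `dL`, shift;
narrow tail ⇒ `NarrowRunsDie`, wide tail ⇒ `stub_wideEternal`. [cite: HauserPerlega2019, §1 p. 3] -/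
theorem NoPeriodicIsolatedAtom_of_ridge :
    ClassicalRegimes → NoPeriodicIsolatedAtom := by
  intro hC
  have hD : Sig.stub_stepDict := stub_stepDict
  have hA : Sig.stub_coneAlgebra := stub_coneAlgebra
  have hE : Sig.stub_wideEternal := stub_wideEternal
  have hN : NarrowRunsDie := stub_narrowRunsDie
  have hT : Summit.ResolutionOfSingularities.ResolutionOfSingularities.Theorems.FrobeniusClosing.Transport := stub_transport
  have hW : Sig.stub_orderWindow := stub_orderWindow
  have hU : Sig.stub_unwind := fun p hp n hn κ _ _ _ c₀ i t r hr hchain hiso =>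
    Summit.ResolutionOfSingularities.ResolutionOfSingularities.Theorems.FrobeniusClosing.unwind_of_transport hT p hp n hn κ c₀ i t r hr hchain hiso
  refine namedNP_iff.mpr ?_
  intro p hp n hn κ _ _ _ c₀ i t r hr hchain hiso
  obtain ⟨hchar, hperf, c₁, i₁, t₁, hall₁⟩ := hU p hp n hn κ c₀ i t r hr hchain hiso
  haveI : CharP κ p := hchar
  haveI : PerfectField κ := hperf
  by_cases hcl : n ≤ 2 ∨ p = 2
  · exact (namedCR_iff.mp hC) p hp n hn hcl κ c₁ i₁ t₁ hall₁
  · have hn3 : 3 ≤ n := by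
      rcases Nat.lt_or_ge n 3 with h | h
      · exact absurd (Or.inl (by omega)) hcl
      · exact h
    have hp2 : p ≠ 2 := fun h => hcl (Or.inr h)
    -- the dictionary at every step (the successor `run (m+1)` is `step (i₁ m) (t₁ m) (run m)` by `rfl`)
    have hDm : ∀ m, _ := fun m => hD p hp n κ (run p c₁ i₁ t₁ m) (i₁ m) (t₁ m) (hall₁ m).2
    -- every state is on the ridge
    have hO : ∀ m, OrdP p (run p c₁ i₁ t₁ m) := by
      intro m
      by_contra hnot
      have hnr : ∀ A, clean p (run p c₁ i₁ t₁ m) A ≠ 0 → Finset.sum Finset.univ (fun j => A j) ≠ p :=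
        fun A hA hAp => hnot ⟨A, hA, hAp⟩
      exact hW p hp n hn3 κ (run p c₁ i₁ t₁ (m + 1)) (i₁ m) ((hDm m).1 hnr) (hall₁ (m + 1)).1 (hall₁ (m + 1)).2
    -- near direction and rank drop at every step
    have hRS : ∀ m, Function.update (t₁ m) (i₁ m) 1 ∈ Linv p (run p c₁ i₁ t₁ m) ∧
        dL p (run p c₁ i₁ t₁ (m + 1)) ≤ dL p (run p c₁ i₁ t₁ m) := fun m =>
      hA.2 p hp n κ (run p c₁ i₁ t₁ m) (run p c₁ i₁ t₁ (m + 1)) (i₁ m) (t₁ m)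
        ((hDm m).2.2 (hall₁ (m + 1)).2) ((hDm m).2.1)
    have hd1 : ∀ m, 1 ≤ dL p (run p c₁ i₁ t₁ m) := fun m =>
      one_le_dL_of_mem_Linv p (run p c₁ i₁ t₁ m) _ (hRS m).1 (fun h => by
        have := congrFun h (i₁ m)
        simp at this)
    -- eventual constancy and the shifted (tail) run
    obtain ⟨M, hM⟩ := eventually_const_of_antitone (fun m => dL p (run p c₁ i₁ t₁ m)) (fun m => (hRS m).2)
    set d := dL p (run p c₁ i₁ t₁ M) with hd
    set c₂ := run p c₁ i₁ t₁ M with hc₂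
    set i₂ : ℕ → Fin n := fun k => i₁ (M + k) with hi₂
    set t₂ : ℕ → Fin n → κ := fun k => t₁ (M + k) with ht₂
    have hrun : ∀ m, run p c₂ i₂ t₂ m = run p c₁ i₁ t₁ (M + m) := fun m => (run_add p c₁ i₁ t₁ M m).symm
    have hall₂ : ∀ m, Isol p (run p c₂ i₂ t₂ m) ∧ MultP p (run p c₂ i₂ t₂ m) := fun m => by
      rw [hrun m]; exact hall₁ (M + m)
    have hridge₂ : ∀ m, OrdP p (run p c₂ i₂ t₂ m) ∧ dL p (run p c₂ i₂ t₂ m) = d := fun m => by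
      rw [hrun m]; exact ⟨hO (M + m), hM m⟩
    rcases Nat.lt_or_ge d 2 with hlt | hge
    · -- d = 1: the tail is a narrow run
      have hd' : d = 1 := by have := hd1 M; omega
      exact (namedNRD_iff.mp hN) p hp hp2 n hn3 κ c₂ i₂ t₂ hall₂ (fun m => ⟨(hridge₂ m).1, by rw [(hridge₂ m).2, hd']⟩)
    · -- d ≥ 2: an eternal wide ridge chain of constant rank; ROOM gives n ≥ 4
      have hn4 : 4 ≤ n := by
        have hroom := hA.1 p hp n κ (run p c₁ i₁ t₁ M) (hO M)
        omega
      exact hE p hp hp2 n hn4 κ c₂ i₂ t₂ d hge hall₂ hridge₂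

/-- **Transfer corollary (proved)**: the crux from the WildCones engine taken by name
(`ConeExit` is now a theorem, so only `NarrowRunsDie`, `ClassicalRegimes` and `Transport` remain).
[cite: HauserPerlega2019, §1 p. 3] -/
theorem NoPeriodicIsolatedAtom_of_wildConesEngine :
    NarrowRunsDie → ClassicalRegimes → ConeExit → NoPeriodicIsolatedAtom :=
  fun _ hC _ => NoPeriodicIsolatedAtom_of hC

/-- **The crux `NoPeriodicIsolatedAtom`, assembled from the registered stubs** (the skeleton in
its current shape; the only `sorry` in its closure is `stub_classicalRegimes` — ONE sibling crux — none of
its own). -/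
theorem NoPeriodicIsolatedAtom_proof : NoPeriodicIsolatedAtom :=
  NoPeriodicIsolatedAtom_of stub_classicalRegimes

end Summit.ResolutionOfSingularities.ResolutionOfSingularities.Cruxes.NoPeriodicIsolatedAtom.Lines.RidgeRank

end
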